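import Mathlib.LinearAlgebra.BilinearForm.Properties
import Mathlib.LinearAlgebra.Projection
import Mathlib.LinearAlgebra.FiniteDimensional.Lemmas
import HarnessLib

/-!
# Two Lagrangians complementary to a common Lagrangian coincide or are transverse
# (r1's THREE-LAGRANGIAN LEMMA, ROUTE-1 §43.1, as a kernel TOOL: `d₃ ∈ {0, 2}`)
(team n1011, row T-LAG3, seat p12 GEN 10; pure linear algebra — no cohomology inside)

HONEST FRAMING (cell `b2b-bsdres`, run/shared/lean/b2b/bsd-rank1-residual/, verbatim in every
file): the goal of the cell is to DELETE the COMBINATION-SHAPED residual classes of the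
Birch–Swinnerton-Dyer formula for ALL analytic-rank `≤ 1` elliptic curves over `ℚ` — "full BSD
formula for every rank `≤ 1` curve in class `C`" assembled STRICTLY from published theorems — so
that the rank-`≤ 1` remainder becomes exactly the CONSTRUCTION-SHAPED classes, which are TYPED
(missing-input `Prop`s), NOT attempted. This is not "finishing BSD". Team n1011 (N10/N11; row
T-LAG3, skeleton `cells/n1011/skel/T-LAG3.md`): research routes on CONSTRUCTION-SHAPED classes;
prove what is provable now; no claim beyond stated classes; census output = EVIDENCE, never a
Literature fact; RESIDUAL-MAP marks UNCHANGED; nothing is booked by this file. TOOL THEOREMS ONLY: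
no definition, no named fact, no cohomology.

## What

Planner r1's ROUTE-1 §43.1 (LEMMA 43.1) reads the local "cost" at the additive place `3` of a
`3`-congruence `θ : E′[3] ⥲ E[3]` as `d₃ := 2 − dim(L_E ∩ θ_* L_{E′})`, where, in the
`4`-dimensional quadratic `𝔽₃`-space `H = H¹(ℚ₃, E[3])` (Tate local duality, symmetric), the
Kummer images `L_E`, `θ_* L_{E′}` are Lagrangians, both complementary to the Lagrangian
`W = ι_* H¹(ℚ₃, ⟨T⟩)` on a `Φ/Φ` `(0,0)` pair. Those cohomological inputs are NOT in this file.
What IS here is the linear algebra behind "`d₃ = 1` is impossible": over ANY field with `2 ≠ 0`,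
for ANY non-degenerate symmetric bilinear form `B` on `V`, an isotropic `W ≤ V` and two isotropic
subspaces `L, L′` each complementary to `W` with `dim L = 2`, EITHER `L = L′` OR `L ⊓ L′ = ⊥`
(`eq_or_inf_eq_bot_of_isotropic_of_isCompl`; `d₃` form `finrank_inf_eq_two_or_eq_zero`). Proof
(§43.1 (a)–(c)): with `π_L`, `π_W` the projections of `V = L ⊕ W`, the form
`C(x′, y′) = B(π_L x′, π_W y′)` on `L′` is SKEW (`L, L′, W` isotropic, `B` symmetric); a vector of
`L′` lies in `L` iff it is in the radical of `C` (`π_L(L′) = L` and non-degeneracy); and a skew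
form on a plane is `0` or non-degenerate (`skew_dichotomy_of_finrank_eq_two`).

References: cells/n1011/ROUTE-1.md §43.1 (planner r1, GEN 31); folklore linear algebra
(Lagrangian complements are graphs of alternating maps), e.g. [MilnorHusemoller1973] J. Milnor,
D. Husemoller, *Symmetric bilinear forms*, Springer 1973, Ch. I §6 (hyperbolic planes) — no
statement of that book is transcribed here.
-/

namespace Summit.BirchSwinnertonDyer.Rank1Residual.GaloisImage.LagrangianDichotomy

open Module Submodule

variable {F : Type*} [Field F]

/-! ## §1 A skew form on a plane is zero or non-degenerate -/

/-- **A skew bilinear form on a `2`-dimensional space is either `0` or non-degenerate** (`2 ≠ 0`):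
if `C(x₀, y₀) ≠ 0` then `x₀, y₀` is a basis (`C(y, y) = 0`) and a vector `a x₀ + b y₀` in the
(right) radical has `a C(x₀,y₀) = 0 = b C(x₀,y₀)`. [folklore] -/
theorem skew_dichotomy_of_finrank_eq_two [NeZero (2 : F)] {U : Type*} [AddCommGroup U]
    [Module F U] (C : LinearMap.BilinForm F U) (hskew : ∀ x y, C x y = -C y x)
    (h2 : finrank F U = 2) :
    (∀ x y, C x y = 0) ∨ (∀ z, (∀ x, C x z = 0) → z = 0) := by
  by_cases h0 : ∀ x y, C x y = 0
  · exact Or.inl h0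
  right
  push Not at h0
  obtain ⟨x₀, y₀, hne⟩ := h0
  have hself : ∀ y, C y y = 0 := fun y ↦ by
    have h : (2 : F) * C y y = 0 := by
      rw [two_mul]
      nth_rewrite 2 [hskew y y]
      exact add_neg_cancel _
    exact (mul_eq_zero.mp h).resolve_left two_ne_zero
  have hli : LinearIndependent F ![x₀, y₀] := by
    rw [LinearIndependent.pair_iff]
    intro s t hst
    have h1 := congrArg (fun v ↦ C v y₀) hst
    have h2 := congrArg (fun v ↦ C x₀ v) hst
    simp only [map_add, map_smul, LinearMap.add_apply, LinearMap.smul_apply, smul_eq_mul,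
      map_zero, LinearMap.zero_apply, hself, mul_zero, add_zero, zero_add] at h1 h2
    exact ⟨(mul_eq_zero.mp h1).resolve_right hne, (mul_eq_zero.mp h2).resolve_right hne⟩
  have hspan : span F (Set.range ![x₀, y₀]) = ⊤ :=
    hli.span_eq_top_of_card_eq_finrank (by rw [h2]; simp)
  intro z hz
  have hzmem : z ∈ span F ({x₀, y₀} : Set U) := by
    rw [← Matrix.range_cons_cons_empty x₀ y₀ ![], hspan]; exact mem_top
  obtain ⟨a, b, rfl⟩ := mem_span_pair.mp hzmem
  have h1 := hz y₀
  have h2 := hz x₀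
  simp only [map_add, map_smul, smul_eq_mul, hself, mul_zero, add_zero, zero_add] at h1 h2
  -- `h1 : a * C y₀ x₀ = 0`, `h2 : b * C x₀ y₀ = 0`
  rw [hskew y₀ x₀, mul_neg, neg_eq_zero] at h1
  rw [(mul_eq_zero.mp h1).resolve_right hne, (mul_eq_zero.mp h2).resolve_right hne, zero_smul,
    zero_smul, add_zero]

/-! ## §2 The dichotomy -/

variable {V : Type*} [AddCommGroup V] [Module F V]

/-- **Two isotropic complements of a common isotropic subspace coincide or are transverse**
(r1's LEMMA 43.1 (a)+(c), ROUTE-1 §43.1; the `d₃ ∈ {0,2}` dichotomy). Let `B` be a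
non-degenerate symmetric bilinear form on a vector space `V` over a field with `2 ≠ 0`,
`W, L, L′ ≤ V` isotropic subspaces with `V = L ⊕ W = L′ ⊕ W` and `dim L = 2`. Then `L = L′` or
`L ⊓ L′ = ⊥`. Proof: `C(x′, y′) := B(π_L x′, π_W y′)` is skew on `L′`
(`0 = B(x′, y′) = C(x′, y′) + C(y′, x′)`); for `z ∈ L′`, `π_W z = 0` iff `C(·, z) = 0` (since
`π_L(L′) = L` — for `l ∈ L`, `π_L(π_{L′} l) = l` — and `B(V, π_W z) = B(L, π_W z) + B(W, π_W z)`);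
`dim L′ = dim V/W = dim L = 2`; by `skew_dichotomy_of_finrank_eq_two` either `C = 0`, whence
`L′ ≤ L` and `L′ = L` (two complements of `W`, modular law), or the radical of `C` is `0`, whence
`L ⊓ L′ = ⊥`. [folklore] -/
theorem eq_or_inf_eq_bot_of_isotropic_of_isCompl [NeZero (2 : F)] (B : LinearMap.BilinForm F V)
    (hB : B.Nondegenerate) (hBs : B.IsSymm) {W L L' : Submodule F V}
    (hW : ∀ x ∈ W, ∀ y ∈ W, B x y = 0) (hL : ∀ x ∈ L, ∀ y ∈ L, B x y = 0)
    (hL' : ∀ x ∈ L', ∀ y ∈ L', B x y = 0) (hLW : IsCompl L W) (hL'W : IsCompl L' W)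
    (h2 : finrank F L = 2) : L = L' ∨ L ⊓ L' = ⊥ := by
  -- the projections of `V = L ⊕ W`
  have hsum : ∀ x : V, L.projection W hLW x + W.projection L hLW.symm x = x :=
    projection_add_projection_eq_self hLW
  have hπL : ∀ x : V, L.projection W hLW x ∈ L := projection_apply_mem hLW
  have hπW : ∀ x : V, W.projection L hLW.symm x ∈ W := projection_apply_mem hLW.symm
  -- the skew form `C(x′, y′) = B(π_L x′, π_W y′)` on `L′`
  let C : LinearMap.BilinForm F L' :=
    B.compl₁₂ (L.projection W hLW ∘ₗ L'.subtype) (W.projection L hLW.symm ∘ₗ L'.subtype)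
  have hC : ∀ x y : L', C x y = B (L.projection W hLW x) (W.projection L hLW.symm y) :=
    fun x y ↦ rfl
  have hskew : ∀ x y : L', C x y = -C y x := by
    intro x y
    have h0 : B (x : V) (y : V) = 0 := hL' x x.2 y y.2
    rw [← hsum (x : V), ← hsum (y : V)] at h0
    simp only [map_add, LinearMap.add_apply] at h0
    rw [hL _ (hπL (x : V)) _ (hπL (y : V)), hW _ (hπW (x : V)) _ (hπW (y : V)), zero_add,
      add_zero, hBs.eq (W.projection L hLW.symm x) (L.projection W hLW y)] at h0
    rw [hC, hC]
    exact eq_neg_of_add_eq_zero_right h0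
  -- `π_L(L′) = L`: for `l ∈ L`, `π_L (π_{L′} l) = l`
  have hontoL : ∀ l ∈ L, ∃ y : L', L.projection W hLW y = l := by
    intro l hl
    refine ⟨⟨L'.projection W hL'W l, projection_apply_mem hL'W l⟩, ?_⟩
    have e := projection_add_projection_eq_self hL'W l
    have h1 : L.projection W hLW (L'.projection W hL'W l) =
        L.projection W hLW l - L.projection W hLW (W.projection L' hL'W.symm l) := by
      rw [eq_sub_iff_add_eq, ← map_add, e]
    rw [Subtype.coe_mk, h1, projection_apply_of_mem_left hLW hl,
      projection_apply_of_mem_right hLW (projection_apply_mem hL'W.symm l), sub_zero]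
  -- radical of `C` = the vectors of `L′` lying in `L`
  have hrad : ∀ z : L', (∀ x : L', C x z = 0) → (z : V) ∈ L := by
    intro z hz
    have hWz : W.projection L hLW.symm z = 0 := by
      refine hB.2 _ fun v ↦ ?_
      rw [← hsum v, map_add, LinearMap.add_apply, hW _ (hπW v) _ (hπW _), add_zero]
      obtain ⟨y, hy⟩ := hontoL _ (hπL v)
      rw [← hy, ← hC, hz y]
    exact (projection_apply_eq_zero_iff hLW.symm).mp hWz
  -- `dim L′ = dim L = 2`
  have h2' : finrank F L' = 2 := by
    rw [← h2, ← (quotientEquivOfIsCompl W L' hL'W.symm).finrank_eq,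
      (quotientEquivOfIsCompl W L hLW.symm).finrank_eq]
  rcases skew_dichotomy_of_finrank_eq_two C hskew h2' with hzero | hnondeg
  · -- `C = 0`: `L′ ≤ L`, hence `L′ = L` (both complements of `W`)
    left
    have hle : L' ≤ L := fun z hz ↦ hrad ⟨z, hz⟩ fun x ↦ hzero x _
    have key : (L' ⊔ W) ⊓ L = L' ⊔ W ⊓ L := sup_inf_assoc_of_le W hle
    rw [hL'W.sup_eq_top, top_inf_eq, inf_comm, hLW.inf_eq_bot, sup_bot_eq] at key
    exact key
  · -- `C` non-degenerate: `L ⊓ L′ = ⊥`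
    right
    rw [eq_bot_iff]
    intro z hz
    rw [mem_bot]
    have hzW : W.projection L hLW.symm z = 0 :=
      (projection_apply_eq_zero_iff hLW.symm).mpr hz.1
    have h := hnondeg ⟨z, hz.2⟩ fun x ↦ by rw [hC, Subtype.coe_mk, hzW, map_zero]
    exact congrArg Subtype.val h

/-- **`d₃ ∈ {0, 2}`** (ROUTE-1 §43.1, corollary): in the situation of
`eq_or_inf_eq_bot_of_isotropic_of_isCompl`, `dim(L ⊓ L′) = 2` (and `L ⊓ L′ = L`) or
`dim(L ⊓ L′) = 0` (and `L ⊓ L′ = ⊥`) — the intermediate value `1` does not occur. [folklore] -/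
theorem finrank_inf_eq_two_or_eq_zero [NeZero (2 : F)] (B : LinearMap.BilinForm F V)
    (hB : B.Nondegenerate) (hBs : B.IsSymm) {W L L' : Submodule F V}
    (hW : ∀ x ∈ W, ∀ y ∈ W, B x y = 0) (hL : ∀ x ∈ L, ∀ y ∈ L, B x y = 0)
    (hL' : ∀ x ∈ L', ∀ y ∈ L', B x y = 0) (hLW : IsCompl L W) (hL'W : IsCompl L' W)
    (h2 : finrank F L = 2) :
    (L ⊓ L' = L ∧ finrank F ↥(L ⊓ L') = 2) ∨ (L ⊓ L' = ⊥ ∧ finrank F ↥(L ⊓ L') = 0) := by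
  rcases eq_or_inf_eq_bot_of_isotropic_of_isCompl B hB hBs hW hL hL' hLW hL'W h2 with h | h
  · left
    subst h
    rw [inf_idem]
    exact ⟨rfl, h2⟩
  · right
    rw [h]
    exact ⟨rfl, finrank_bot F V⟩

/-- **The setting of ROUTE-1 §43.1 literally**: `dim V = 4`, `B` non-degenerate symmetric, `W` a
`2`-dimensional isotropic subspace, `L, L′` two `2`-dimensional isotropic subspaces TRANSVERSE to
`W` (`L ⊓ W = ⊥ = L′ ⊓ W`, the `(A, A′) = (0, 0)` situation). Then `L = L′` or `L ⊓ L′ = ⊥`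
(transversality + dimension count give the complements, `Submodule.isCompl_iff_disjoint`).
[folklore] -/
theorem eq_or_inf_eq_bot_of_finrank_eq_four [NeZero (2 : F)] [FiniteDimensional F V]
    (B : LinearMap.BilinForm F V) (hB : B.Nondegenerate) (hBs : B.IsSymm)
    (hV : finrank F V = 4) {W L L' : Submodule F V}
    (hW : ∀ x ∈ W, ∀ y ∈ W, B x y = 0) (hL : ∀ x ∈ L, ∀ y ∈ L, B x y = 0)
    (hL' : ∀ x ∈ L', ∀ y ∈ L', B x y = 0) (hWd : finrank F W = 2) (h2 : finrank F L = 2)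
    (h2' : finrank F L' = 2) (hLW : L ⊓ W = ⊥) (hL'W : L' ⊓ W = ⊥) :
    L = L' ∨ L ⊓ L' = ⊥ :=
  eq_or_inf_eq_bot_of_isotropic_of_isCompl B hB hBs hW hL hL'
    ((isCompl_iff_disjoint L W (by rw [hV, h2, hWd])).mpr (disjoint_iff.mpr hLW))
    ((isCompl_iff_disjoint L' W (by rw [hV, h2', hWd])).mpr (disjoint_iff.mpr hL'W)) h2

end Summit.BirchSwinnertonDyer.Rank1Residual.GaloisImage.LagrangianDichotomy
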